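import Literature.AlgebraicGeometry.Ramification.ArtinSchreierSwanConductor
import Literature.AlgebraicGeometry.Ramification.LogDifferentials
import Mathlib.AlgebraicGeometry.IdealSheaf.Basic
import Mathlib.AlgebraicGeometry.FunctionField
import Mathlib.RingTheory.RegularLocalRing.Defs
import HarnessLib

/-!
# Kato's refined Swan conductor and CLEANLINESS of an Artin–Schreier class along a strict
# normal crossings divisor (Kato 1989 §§3–4; Kato 1994 (3.4.2)–(3.4.3); Yatagawa 2022 Def. 1.29)

Topic: `Literature/AlgebraicGeometry/Ramification` (definition request `defn-KatoCleanRamification`,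
Stage 1: rank one, classes of order `p`). Requested by route
`Summits/ResolutionOfSingularities/…/Theses/CleanCovers` (items `CleanSolvableModel`,
`CleanCoverLogRegular`, `ASCoverResolution`), whose wild ramification is filtered by elementary
abelian Artin–Schreier layers `z^p - z = f`.

## The printed definitions

Setting (Yatagawa 2022, Conventions p. 4–5; Kato 1994 §3): `X` smooth over a perfect field `k` of
characteristic `p` (Kato: regular), `D = ⋃_{i∈I} Dᵢ` a divisor with simple normal crossings,
`U = X ∖ D`, `χ ∈ H¹(U, ℚ/ℤ)` a character (here: of order `p`, `χ = δ₁(f)`, `f ∈ Γ(U, 𝒪)`), `Kᵢ`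
the local field at the generic point `𝔭ᵢ` of `Dᵢ`.
* **Swan conductor divisor** (Kato 1994 (3.4); Yatagawa 2022 Def. 1.19): `R_χ = Σᵢ sw(χ|_{Kᵢ}) Dᵢ`
  and `Z_χ = Supp R_χ = ⋃_{sw(χ|Kᵢ) ≥ 1} Dᵢ` (reduced).
* **Refined Swan conductor** (Kato 1989 Thm. (3.2) locally; Kato 1994 (3.4.2), Yatagawa 2022
  Def. 1.22 with Rem. 1.23 (2),(4),(5) globally): for a local section `a` of `fil_R j_*W_s(𝒪_U)`
  representing `χ` (for `s = 1`: `a = f` with `div(f) ≥ -R` near the point),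
  `rsw(χ) = -F^{s-1}da = -Σ aᵢ^{p^i - 1} daᵢ` (for `s = 1`: `rsw(χ) = -df`) as a section of
  `gr_R j_*Ω¹_U = Ω¹_X(log D)(R) ⊗ 𝒪_{Z_χ}`, a locally free `𝒪_{Z_χ}`-module; it does not depend
  on the representative. With `f = u/∏ zᵢ^{nᵢ}` (`nᵢ = sw(χ|Kᵢ)`, `zᵢ` local equations of the
  branches at `x`): `-df = -(du - u Σᵢ nᵢ dlog zᵢ)/∏ zᵢ^{nᵢ}`.
* **Cleanliness** (Kato 1994 (3.4.3) = Yatagawa 2022 Def. 1.29 with `D' = D`, Rem. 1.30 (3)):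
  `χ` is clean at `x ∈ X` iff (a) `x ∉ Z_χ`, or (b) `x ∈ Z_χ` and the germ `rsw(χ)_x` is part of a
  basis of the free `𝒪_{Z_χ,x}`-module `(Ω¹_X(log D)(R) ⊗ 𝒪_{Z_χ})_x` — equivalently (Nakayama;
  Yatagawa Lemma 1.31 (1)) `rsw(χ)(x) ≠ 0` in the fibre at `x`; `χ` is clean along `D` iff clean
  at every point. It is an open condition on `X`, automatic off a closed subset of codimension
  `≥ 2` (Yatagawa Rem. 1.30 (2), by Kato 1989 Thm. (3.2) = Yatagawa Rem. 1.11 at the generic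
  points of `Z_χ`), and on surfaces it is achieved after finitely many point blow-ups (Kato 1994
  Thm. 4.1). Abbes–Saito 2011 §1.11: "The notion of cleanliness was first introduced by Kato for
  rank 1 sheaves. Our definition extends his."

## Rendering (local ring level first, then schemes)

Everything is phrased for the local ring `A = 𝒪_{X,x}` (`x ∈ D`) mapping to the function field
`K`, local equations `z : Fin n → A` of the branches `D₁,…,D_n` of `D` through `x` (part of a
regular system of parameters, `Literature.AlgebraicGeometry.Resolution.IsRsopPart`, not assumed
by the definitions) and a rational function `f ∈ K` representing `χ` on `U` near `x`:
* `conductorVector p z f i = sw_{Dᵢ}(f)` (`ArtinSchreierSwanConductor.swanConductor` at `V(zᵢ)`;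
  `A_{(zᵢ)} = 𝒪_{X,𝔭ᵢ}`, so this is `sw(χ|_{Kᵢ})`, loc. cit. module docstring) — the germ of
  `R_χ` at `x`;
* `IsNormalForm p z f u`: `f - ℘(g) = u / ∏ zᵢ^{nᵢ}` for some `g ∈ K`, `u ∈ A` — a representative
  in `fil_R` at `x` (Yatagawa Def. 1.13 (1), `s = 1`); such `u` exist for `X` regular (purity of
  the Zariski sheaf `fil_R R¹(εj)_*ℤ/p`, implicit in Kato 1994 (3.4.2) / Yatagawa Def. 1.22) —
  NOT proved here, whence the existential in `IsCleanAt`;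
* `rswForm z R u = -(du - u Σ Rᵢ dlog zᵢ) ∈ Ω¹_A(log D)` (`LogDifferentials.LogDifferential`):
  the refined Swan conductor in the local frame `∏ zᵢ^{-Rᵢ}` of `𝒪_X(R)`, and
  `refinedSwanConductor z R u` its class modulo `I_Z · Ω¹_A(log D)`, `I_Z = (∏_{Rᵢ≠0} zᵢ)` the
  ideal of `Z = Supp R` (`wildSupportIdeal`) — Kato's `rsw(χ)_x`; its independence of the normal
  form (`u' = u + ∏z^R ℘(w/∏z^{R'})`, `pR' ≤ R`, changes `rswForm` by an element of
  `I_Z Ω¹_A(log D)`) is NOT proved here;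
* `IsCleanAt p z f` (at the closed point of `A`): all `sw_{Dᵢ}(f) = 0` (`x ∉ Z_χ`), or some normal
  form `u` has `rswForm ∉ 𝔪_A · Ω¹_A(log D)`, i.e. `rsw(χ)(x) ≠ 0` in the fibre
  `Ω¹_A(log D) ⊗ κ(x)` (Yatagawa Lemma 1.31 (1)); by the independence just quoted "some" = "every".
* Schemes: `Scheme.IsKatoCleanAt X p D f x` for an integral scheme `X`, a subset `D` (meant: a
  strict normal crossings divisor, `Literature.AlgebraicGeometry.Resolution.
  IsStrictNormalCrossingsDivisor X D`), `f ∈ K(X)` and `x ∈ X`: `x ∉ D`, or there are local snc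
  coordinates `(z; y)` at `x` (the shape of `IsStrictNormalCrossingsDivisor`, verbatim) in which
  `IsCleanAt p z f` holds for `A = 𝒪_{X,x} → K(X)`. The local predicate is invariant under
  permuting the `zᵢ` and multiplying them by units, so it only depends on the branches of `D` at
  `x`; `Scheme.IsKatoClean X p D f`: clean at every point (Yatagawa Def. 1.29 (2)).

## Proved here (sanity / the criteria consumers use)

* `isCleanAt_of_forall_conductorVector_eq_zero` (case (a)); `Scheme.isKatoCleanAt_of_not_mem`.
* `rswForm_mem_iff` / `rswForm_not_mem_iff`: `rsw(x) ≠ 0` iff SOME `nᵢ·u` is a unit of `A`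
  (for `A` of characteristic `p`: `p ∤ nᵢ` and `u ∈ A^×`, `natCast_mul_not_mem_iff`) OR
  `du ∉ 𝔪 Ω¹_A + Σ A dzᵢ` (i.e. `d(u|_{D_{I}})(x) ≠ 0`): Kato's dichotomy of clean points into the
  "unit" (Type I) and the "differential"/fierce (Type II) kind, cf. the payload's two displayed
  criteria for `D` smooth.
* `rswForm_not_mem_of_isUnit` (unit case is clean), `D_mem_of_sub_pow_mem` and
  `sub_pow_not_mem_of_rswForm_not_mem`: when no `nᵢ u` is a unit (e.g. all `p ∣ nᵢ`, or
  `u ∈ 𝔪`), cleanliness forces `u - a^p ∉ 𝔪² + (z₁,…,z_n)` for every `a ∈ A` — the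
  transversality hypothesis of the route's `FierceCleanRegular`.

## NOT here (and why)

* Stage 2 of the request — cleanliness of a general finite Galois torsor / lcc sheaf
  (Abbes–Saito 2011 Def. (clean7)/(clean8) = 1.11): it quantifies over log-smooth morphisms of
  snc pairs and uses the logarithmic ramification filtration, `R`-specialisation and the
  Fourier–Deligne transform (loc. cit. §§1.9–1.11, 6–8), none of which the tree has; the route
  uses cleanliness layer by layer on Artin–Schreier classes, which is this file (for isoclinic
  rank-1 layers the notions agree, loc. cit. §1.11 and (clean11)).
* Witt-vector classes of order `p^s`, `s ≥ 2`; the non-log variants (`dt`, `char`, log-`D'`).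
* The theorems: independence of `rsw` from the normal form and existence of normal forms
  (purity); openness of the clean locus and cleanliness in codimension `≤ 1` (Kato 1989 Thm. 3.2;
  needs `da = 0 ⇒ a ∈ F^p` for fields); Kato 1994 Thm. 4.1 (separate cite request of the route).

## Sources

* K. Kato, Contemp. Math. 83 (1989), Def. (2.2), Thm. (3.2), §§3–4. [Kato1989] (cite-only.)
* K. Kato, *Class field theory, 𝒟-modules, and ramification on higher dimensional schemes I*,
  Amer. J. Math. 116 (1994), (3.4.2), (3.4.3), Thm. 4.1. [Kato1994Ramification] (cite-only; the
  statements are taken from Yatagawa 2022 Rem. 1.23 (4), Def. 1.29, Rem. 1.30 (3) and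
  Abbes–Saito 2011 §1.11, §1.13, which restate them.)
* Y. Yatagawa, arXiv:2206.02989 (2022), Def. 1.13, 1.19, 1.22, Rem. 1.23, Def. 1.29, Rem. 1.30,
  Lemma 1.31. [Yatagawa2022]
* A. Abbes, T. Saito, Tohoku Math. J. 63 (2011), §1.10–1.13. [AbbesSaito2011]
-/

noncomputable section

namespace Literature.AlgebraicGeometry.Ramification

universe u v

open IsLocalRing

/-! ## Local theory at a point of the divisor -/

section Local

variable {A : Type u} [CommRing A] {K : Type v} [Field K] [Algebra A K]
variable (p : ℕ) {n : ℕ} (z : Fin n → A) (f : K)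

/-- **The Swan conductor vector at `x`** (germ of Kato's conductor divisor `R_χ = Σ sw(χ|Kᵢ) Dᵢ`,
Kato 1994 (3.4) / Yatagawa 2022 Def. 1.19 (1), for a class of order `p`): the Swan conductor of
the Artin–Schreier class of `f` at each branch `V(zᵢ)` of the divisor through the point.
[cite: Yatagawa2022, Def. 1.19 (1)] -/
def conductorVector : Fin n → ℕ := fun i => swanConductor p (z i) f

/-- Unfolding lemma. [folklore] -/
theorem conductorVector_apply (i : Fin n) : conductorVector p z f i = swanConductor p (z i) f :=
  rfl

/-- The monomial `z^R = ∏ zᵢ^{Rᵢ}`, a local equation of the divisor `R = Σ Rᵢ Dᵢ`. [folklore] -/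
def monomial (R : Fin n → ℕ) : A := ∏ i, z i ^ R i

/-- **Normal form** of the class of `f` at the point: `u ∈ A` with `f - ℘(g) = u / ∏ zᵢ^{nᵢ}` for
some `g ∈ K`, `n` the Swan conductor vector — a representative of `χ` lying in Kato's
`fil_R j_*𝒪_U` at `x` (Yatagawa 2022 Def. 1.13 (1)–(2) with `s = 1`: pole order `≤ sw(χ|Kᵢ)`
along every branch and no other pole). Written multiplicatively (`(f - ℘ g) · z^n = u` in `K`).
[cite: Yatagawa2022, Def. 1.13] -/
def IsNormalForm (u : A) : Prop :=
  ∃ g : K, (f - artinSchreier p g) * algebraMap A K (monomial z (conductorVector p z f)) =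
    algebraMap A K u

variable {p f} in
/-- Unfolding lemma. [folklore] -/
theorem isNormalForm_iff (u : A) : IsNormalForm p z f u ↔
    ∃ g : K, (f - artinSchreier p g) * algebraMap A K (monomial z (conductorVector p z f)) =
      algebraMap A K u :=
  Iff.rfl

/-- **The refined Swan conductor form** of a normal form `u / z^R`:
`rsw = -(du - u · Σᵢ Rᵢ dlog zᵢ) ∈ Ω¹_A(log D)`, i.e. Kato's `rsw(χ) = -d(u/z^R)` written in the
local frame `z^{-R}` of `𝒪_X(R)` (Kato 1989 Thm. (3.2) / Yatagawa 2022 (1.21)–(1.24), Def. 1.22,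
Rem. 1.23 (2): `rsw = -F^{s-1}da`, `= -da` for `s = 1`). [cite: Yatagawa2022, Def. 1.22] -/
def rswForm (R : Fin n → ℕ) (u : A) : LogDifferential A z :=
  -(LogDifferential.d A z u - u • ∑ i, ((R i : ℕ) : A) • LogDifferential.dlog A z i)

/-- The ideal `I_Z = (∏_{Rᵢ ≠ 0} zᵢ)` of the (reduced) support `Z = Supp R = ⋃_{Rᵢ≠0} Dᵢ` of the
conductor divisor at the point (Yatagawa 2022 Def. 1.19 (2): `Z_χ = ⋃_{sw ≥ 1} Dᵢ` with the
reduced structure). [cite: Yatagawa2022, Def. 1.19 (2)] -/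
def wildSupportIdeal (R : Fin n → ℕ) : Ideal A :=
  Ideal.span {∏ i ∈ Finset.univ.filter (fun i => R i ≠ 0), z i}

/-- **Kato's refined Swan conductor** `rsw(χ)_x`: the class of `rswForm` in
`Ω¹_A(log D) ⊗ 𝒪_{Z,x} = Ω¹_A(log D)/I_Z·Ω¹_A(log D)` (in the frame `z^{-R}` of `𝒪_X(R)`), the germ
at `x` of the global section `rsw(χ) ∈ Γ(Z, Ω¹_X(log D)(R)|_Z)` (Kato 1994 (3.4.2); Yatagawa 2022
Def. 1.22, Rem. 1.23 (4)–(5)). Independent of the normal form `u` (Kato; not proved here).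
[cite: Kato1994Ramification, (3.4.2)] -/
def refinedSwanConductor (R : Fin n → ℕ) (u : A) :
    LogDifferential A z ⧸ (wildSupportIdeal z R • (⊤ : Submodule A (LogDifferential A z))) :=
  Submodule.Quotient.mk (rswForm z R u)

/-- **Kato-cleanliness at the closed point** of `A = 𝒪_{X,x}` of the Artin–Schreier class of `f`
along `D = V(∏ zᵢ)` (Kato 1994 (3.4.3); Yatagawa 2022 Def. 1.29 (1) with `D' = D`, Lemma 1.31
(1)): either (a) every branch through `x` is tame, `sw_{Dᵢ}(f) = 0` (`x ∉ Z_χ`), or (b) for a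
normal form `f ∼ u/∏ zᵢ^{nᵢ}` the refined Swan conductor does not vanish at `x`:
`-(du - uΣnᵢ dlog zᵢ) ∉ 𝔪_x · Ω¹_A(log D)`, i.e. `rsw(χ)_x` is part of a basis of
`(Ω¹_X(log D)(R) ⊗ 𝒪_Z)_x`. ("Some normal form" = "every normal form" by the independence of `rsw`;
if no normal form exists — impossible on a regular `X` — (b) fails.)
[cite: Kato1994Ramification, (3.4.3)] -/
def IsCleanAt [IsLocalRing A] : Prop :=
  (∀ i, conductorVector p z f i = 0) ∨
    ∃ u : A, IsNormalForm p z f u ∧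
      rswForm z (conductorVector p z f) u ∉
        (maximalIdeal A • (⊤ : Submodule A (LogDifferential A z)))

variable {p z f}

/-- Unfolding lemma for `IsCleanAt`. [folklore] -/
theorem isCleanAt_iff [IsLocalRing A] : IsCleanAt p z f ↔
    (∀ i, conductorVector p z f i = 0) ∨
      ∃ u : A, IsNormalForm p z f u ∧
        rswForm z (conductorVector p z f) u ∉
          (maximalIdeal A • (⊤ : Submodule A (LogDifferential A z))) :=
  Iff.rfl

/-- **Tame points are clean** (case (a): `x ∉ Z_χ`; Yatagawa 2022 Def. 1.29 (1)(a), Rem. 1.30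
(1)). [cite: Yatagawa2022, Rem. 1.30 (1)] -/
theorem isCleanAt_of_forall_conductorVector_eq_zero [IsLocalRing A]
    (h : ∀ i, conductorVector p z f i = 0) : IsCleanAt p z f :=
  Or.inl h

/-- With no branch through the point (`n = 0`) every class is clean. [folklore] -/
theorem isCleanAt_of_isEmpty [IsLocalRing A] [IsEmpty (Fin n)] : IsCleanAt p z f :=
  Or.inl fun i => isEmptyElim i

/-! ### The refined Swan conductor form in coordinates, and the fibre criterion -/

/-- `rswForm = [(-du, (Rᵢ u)ᵢ)]` in the presentation `Ω¹_A × Aⁿ ↠ Ω¹_A(log D)`. [folklore] -/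
theorem rswForm_eq_mk (R : Fin n → ℕ) (u : A) :
    rswForm z R u = LogDifferential.mk A z (-KaehlerDifferential.D ℤ A u, fun i => (R i : A) * u) := by
  rw [LogDifferential.mk_eq, rswForm, LogDifferential.d_apply, ← LogDifferential.ofKaehler_apply,
    Finset.smul_sum, neg_sub, sub_eq_neg_add, map_neg]
  congr 1
  refine Finset.sum_congr rfl fun i _ => ?_
  rw [smul_smul, mul_comm]

/-- **Fibre criterion for the refined Swan conductor**: if all `zᵢ ∈ 𝔪` then
`rswForm ∈ 𝔪 · Ω¹_A(log D)` iff every `Rᵢ · u ∈ 𝔪` and `du ∈ 𝔪 Ω¹_A + Σᵢ A dzᵢ`. [folklore] -/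
theorem rswForm_mem_iff [IsLocalRing A] (hz : ∀ i, z i ∈ maximalIdeal A) (R : Fin n → ℕ) (u : A) :
    rswForm z R u ∈ (maximalIdeal A • (⊤ : Submodule A (LogDifferential A z))) ↔
      (∀ i, (R i : A) * u ∈ maximalIdeal A) ∧
        KaehlerDifferential.D ℤ A u ∈ maximalIdeal A • (⊤ : Submodule A Ω[A⁄ℤ]) ⊔
          Submodule.span A (Set.range fun i => KaehlerDifferential.D ℤ A (z i)) := by
  rw [rswForm_eq_mk, LogDifferential.mk_mem_smul_top_iff hz, neg_mem_iff]

/-- **Kato's dichotomy at a point of `Z_χ`** (contrapositive form of `rswForm_mem_iff`): the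
refined Swan conductor does not vanish at the closed point iff SOME `Rᵢ · u` is a unit ("unit"
or Type-I behaviour: `p ∤ Rᵢ` and `u(x) ≠ 0`) OR `du ∉ 𝔪 Ω¹_A + Σ A dzᵢ` (the differential of
`u` restricted to the stratum `⋂ Dᵢ` does not vanish at `x`). [folklore] -/
theorem rswForm_not_mem_iff [IsLocalRing A] (hz : ∀ i, z i ∈ maximalIdeal A) (R : Fin n → ℕ)
    (u : A) :
    rswForm z R u ∉ (maximalIdeal A • (⊤ : Submodule A (LogDifferential A z))) ↔
      (∃ i, (R i : A) * u ∉ maximalIdeal A) ∨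
        KaehlerDifferential.D ℤ A u ∉ maximalIdeal A • (⊤ : Submodule A Ω[A⁄ℤ]) ⊔
          Submodule.span A (Set.range fun i => KaehlerDifferential.D ℤ A (z i)) := by
  rw [rswForm_mem_iff hz, not_and_or, not_forall]

/-- In a ring of prime characteristic `p`, `m · u` is a unit iff `p ∤ m` and `u` is a unit.
[folklore] -/
theorem isUnit_natCast_mul_iff (p : ℕ) [Fact p.Prime] [CharP A p] (m : ℕ) (u : A) :
    IsUnit ((m : A) * u) ↔ ¬p ∣ m ∧ IsUnit u := by
  have hp : p.Prime := Fact.out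
  haveI : Nontrivial A := CharP.nontrivial_of_char_ne_one hp.ne_one
  rw [IsUnit.mul_iff]
  refine and_congr ⟨fun h hd => ?_, fun h => ?_⟩ Iff.rfl
  · rw [(CharP.cast_eq_zero_iff A p m).mpr hd] at h
    exact not_isUnit_zero h
  · obtain ⟨a, b, hab⟩ := (hp.coprime_iff_not_dvd.mpr h).isCoprime
    apply_fun ((↑) : ℤ → A) at hab
    push_cast at hab
    rw [CharP.cast_eq_zero A p, mul_zero, zero_add, mul_comm] at hab
    exact .of_mul_eq_one b hab

/-- The unit clause of the dichotomy in characteristic `p`: `Rᵢ u ∉ 𝔪` iff `p ∤ Rᵢ` and `u` is a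
unit. [folklore] -/
theorem natCast_mul_not_mem_iff [IsLocalRing A] (p : ℕ) [Fact p.Prime] [CharP A p] (m : ℕ)
    (u : A) : (m : A) * u ∉ maximalIdeal A ↔ ¬p ∣ m ∧ IsUnit u := by
  rw [IsLocalRing.mem_maximalIdeal, mem_nonunits_iff, not_not, isUnit_natCast_mul_iff p]

/-- **The unit case is clean**: if `u` is a unit and some `Rᵢ` is a unit of `A` (in characteristic
`p`: `p ∤ Rᵢ`), the refined Swan conductor does not vanish at the closed point (its `dlog zᵢ`
component is `Rᵢ u(x) ≠ 0`). [folklore] -/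
theorem rswForm_not_mem_of_isUnit [IsLocalRing A] (hz : ∀ i, z i ∈ maximalIdeal A)
    {R : Fin n → ℕ} {u : A} (hu : IsUnit u) (i : Fin n) (hi : IsUnit (R i : A)) :
    rswForm z R u ∉ (maximalIdeal A • (⊤ : Submodule A (LogDifferential A z))) :=
  (rswForm_not_mem_iff hz R u).mpr
    (Or.inl ⟨i, fun h => (IsLocalRing.mem_maximalIdeal _).mp h (hi.mul hu)⟩)

/-- Differentials of `p`-th powers, of `𝔪²` and of `(z₁,…,z_n)` die in the fibre
`(Ω¹_A ⊗ κ)/⟨dzᵢ⟩`: if `u - a^p ∈ 𝔪² + (z)` then `du ∈ 𝔪 Ω¹_A + Σ A dzᵢ` (characteristic `p`).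
[folklore] -/
theorem D_mem_of_sub_pow_mem [IsLocalRing A] (p : ℕ) [CharP A p]
    (hz : ∀ i, z i ∈ maximalIdeal A) {u a : A}
    (h : u - a ^ p ∈ maximalIdeal A ^ 2 ⊔ Ideal.span (Set.range z)) :
    KaehlerDifferential.D ℤ A u ∈ maximalIdeal A • (⊤ : Submodule A Ω[A⁄ℤ]) ⊔
      Submodule.span A (Set.range fun i => KaehlerDifferential.D ℤ A (z i)) := by
  set M := maximalIdeal A • (⊤ : Submodule A Ω[A⁄ℤ]) ⊔
      Submodule.span A (Set.range fun i => KaehlerDifferential.D ℤ A (z i)) with hM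
  -- `d(a^p) = p a^{p-1} da = 0`
  have hpow : KaehlerDifferential.D ℤ A (a ^ p) = 0 := by
    rw [Derivation.leibniz_pow, ← Nat.cast_smul_eq_nsmul A, CharP.cast_eq_zero, zero_smul]
  -- `d(𝔪²) ⊆ 𝔪 Ω`
  have hsq : ∀ v ∈ maximalIdeal A ^ 2, KaehlerDifferential.D ℤ A v ∈ M := by
    intro v hv
    rw [pow_two] at hv
    refine Submodule.mul_induction_on hv (fun x hx y hy => ?_) (fun x y hx hy => ?_)
    · rw [Derivation.leibniz]
      exact Submodule.mem_sup_left (Submodule.add_mem _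
        (Submodule.smul_mem_smul hx Submodule.mem_top) (Submodule.smul_mem_smul hy Submodule.mem_top))
    · rw [map_add]; exact Submodule.add_mem _ hx hy
  -- `d((z)) ⊆ 𝔪 Ω + Σ A dzᵢ`
  have hspan : ∀ w ∈ Ideal.span (Set.range z), KaehlerDifferential.D ℤ A w ∈ M := by
    intro w hw
    refine Submodule.span_induction (fun x hx => ?_) (by simp) (fun x y _ _ hx hy => ?_)
      (fun c x _ hx => ?_) hw
    · obtain ⟨i, rfl⟩ := hx
      exact Submodule.mem_sup_right (Submodule.subset_span ⟨i, rfl⟩)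
    · rw [map_add]; exact Submodule.add_mem _ hx hy
    · rw [smul_eq_mul, Derivation.leibniz]
      refine Submodule.add_mem _ (Submodule.smul_mem _ _ hx) ?_
      -- `x • dc` with `x ∈ (z) ⊆ 𝔪`
      have hxm : x ∈ maximalIdeal A := by
        refine (Ideal.span_le.mpr ?_) ‹x ∈ Ideal.span (Set.range z)›
        rintro _ ⟨i, rfl⟩; exact hz i
      exact Submodule.mem_sup_left (Submodule.smul_mem_smul hxm Submodule.mem_top)
  obtain ⟨v, hv, w, hw, hvw⟩ := Submodule.mem_sup.mp h
  have hu : u = a ^ p + v + w := by rw [add_assoc, hvw]; ring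
  rw [hu, map_add, map_add, hpow, zero_add]
  exact Submodule.add_mem _ (hsq v hv) (hspan w hw)

/-- **Cleanliness without units forces transversality** (the fierce/"differential" case): if no
`Rᵢ · u` is a unit (all `p ∣ Rᵢ`, or `u(x) = 0`) and the refined Swan conductor does not vanish at
`x`, then `u - a^p ∉ 𝔪² + (z₁, …, z_n)` for every `a ∈ A` — with `a = 0`: `u ∉ 𝔪² + (z)`. This is
the hypothesis of the route's `FierceCleanRegular`. [folklore] -/
theorem sub_pow_not_mem_of_rswForm_not_mem [IsLocalRing A] (p : ℕ) [CharP A p]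
    (hz : ∀ i, z i ∈ maximalIdeal A) {R : Fin n → ℕ} {u : A}
    (hR : ∀ i, (R i : A) * u ∈ maximalIdeal A)
    (h : rswForm z R u ∉ (maximalIdeal A • (⊤ : Submodule A (LogDifferential A z)))) (a : A) :
    u - a ^ p ∉ maximalIdeal A ^ 2 ⊔ Ideal.span (Set.range z) := fun hmem =>
  ((rswForm_not_mem_iff hz R u).mp h).elim (fun ⟨i, hi⟩ => hi (hR i))
    (fun hD => hD (D_mem_of_sub_pow_mem p hz hmem))

end Local

/-! ## Cleanliness along a strict normal crossings divisor of an integral scheme -/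

section Scheme

-- `open _root_.…`: inside `namespace Literature.AlgebraicGeometry.…` a bare `open AlgebraicGeometry`
-- would open `Literature.AlgebraicGeometry` (CONVENTIONS §2).
open _root_.AlgebraicGeometry _root_.CategoryTheory _root_.TopologicalSpace
open _root_.AlgebraicGeometry.Scheme.IdealSheafData

variable (X : Scheme.{u}) [IsIntegral X]

/-- **Kato-cleanliness at a point** `x ∈ X` of the Artin–Schreier class of the rational function
`f ∈ K(X)` along `D ⊆ X` (an integral scheme; `D` is meant to be a strict normal crossings
divisor, `U = X ∖ D`, `f` regular on `U` near `x`, so that `z^p - z = f` is a `ℤ/p`-torsor on `U`):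
either `x ∉ D`, or there are local snc coordinates at `x` — a regular system of parameters
`z₁,…,z_r, y₁,…,y_e` of `𝒪_{X,x}` with `(I_D)_x = (z₁ ⋯ z_r)`, literally the local clause of
`Literature.AlgebraicGeometry.Resolution.IsStrictNormalCrossingsDivisor` — in which the class of
`f` is clean at the closed point of `𝒪_{X,x} → K(X)` (`IsCleanAt`). Kato 1994 (3.4.3) /
Yatagawa 2022 Def. 1.29 (1); the local predicate does not depend on the choice of `(z; y)`
(units and permutations), cf. module docstring. [cite: Kato1994Ramification, (3.4.3)] -/
def Scheme.IsKatoCleanAt (p : ℕ) (D : Set X) (f : X.functionField) (x : X) : Prop :=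
  x ∉ D ∨ ∃ (r e : ℕ) (z : Fin r → X.presheaf.stalk x) (y : Fin e → X.presheaf.stalk x),
      1 ≤ r ∧ ringKrullDim (X.presheaf.stalk x) = (r + e : ℕ) ∧
      Ideal.span (Set.range z ∪ Set.range y) = maximalIdeal (X.presheaf.stalk x) ∧
      (∀ (U : X.affineOpens) (hU : x ∈ (U : X.Opens)),
        ((vanishingIdeal ⟨closure D, isClosed_closure⟩).ideal U).map
          (X.presheaf.germ U x hU).hom = Ideal.span {∏ i, z i}) ∧
      IsCleanAt (K := X.functionField) p z f

/-- **Kato-cleanliness along `D`** of the Artin–Schreier class of `f ∈ K(X)`: clean at every point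
of `X` (Kato 1994 (3.4.3); Yatagawa 2022 Def. 1.29 (2)). [cite: Yatagawa2022, Def. 1.29 (2)] -/
def Scheme.IsKatoClean (p : ℕ) (D : Set X) (f : X.functionField) : Prop :=
  ∀ x : X, Scheme.IsKatoCleanAt X p D f x

variable {X}

/-- Points off the divisor are clean. [folklore] -/
theorem Scheme.isKatoCleanAt_of_not_mem {p : ℕ} {D : Set X} {f : X.functionField} {x : X}
    (hx : x ∉ D) : Scheme.IsKatoCleanAt X p D f x :=
  Or.inl hx

/-- Unfolding: cleanliness along `D` is cleanliness at every point of `D` (it is automatic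
elsewhere). [folklore] -/
theorem Scheme.isKatoClean_iff {p : ℕ} {D : Set X} {f : X.functionField} :
    Scheme.IsKatoClean X p D f ↔ ∀ x ∈ D, Scheme.IsKatoCleanAt X p D f x :=
  ⟨fun h x _ => h x, fun h x => (em (x ∈ D)).elim (h x) Scheme.isKatoCleanAt_of_not_mem⟩

/-- Every class is clean along the empty divisor. [folklore] -/
theorem Scheme.isKatoClean_empty (p : ℕ) (f : X.functionField) : Scheme.IsKatoClean X p ∅ f :=
  fun _ => Or.inl (Set.notMem_empty _)

end Scheme

end Literature.AlgebraicGeometry.Ramification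

end
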